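import Summits.CriticalPhenomena.PercolationContinuityZ3.Theorems.PercNearOneGluingNoHeavyLowerTailMajorityGluingZThirteenEightP1
import Summits.CriticalPhenomena.PercolationContinuityZ3.Theorems.PercNearOneGluingNoHeavyLowerTailMajorityGluingZThirteenEightP2
import Summits.CriticalPhenomena.PercolationContinuityZ3.Theorems.PercNearOneGluingNoHeavyLowerTailMajorityGluingZThirteenEightP3
import Summits.CriticalPhenomena.PercolationContinuityZ3.Theorems.PercNearOneGluingNoHeavyLowerTailMajorityGluingZThirteenEightP4
import Summits.CriticalPhenomena.PercolationContinuityZ3.Theorems.PercNearOneGluingNoHeavyLowerTailMajorityGluingZThirteenEightP5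
import Summits.CriticalPhenomena.PercolationContinuityZ3.Theorems.PercNearOneGluingNoHeavyLowerTailMajorityGluingZThirteenEightP6
import Summits.CriticalPhenomena.PercolationContinuityZ3.Theorems.PercNearOneGluingNoHeavyLowerTailMajorityGluingZThirteenEightP7
import Summits.CriticalPhenomena.PercolationContinuityZ3.Theorems.PercNearOneGluingNoHeavyLowerTailMajorityGluingZThirteenEightP8
import Summits.CriticalPhenomena.PercolationContinuityZ3.Theorems.PercNearOneGluingNoHeavyLowerTailMajorityGluingZThirteenEightP9
import Summits.CriticalPhenomena.PercolationContinuityZ3.Theorems.PercNearOneGluingNoHeavyLowerTailMajorityGluingZThirteenEightP10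
import Summits.CriticalPhenomena.PercolationContinuityZ3.Theorems.PercNearOneGluingNoHeavyLowerTailMajorityGluingZThirteenEightP11
import Summits.CriticalPhenomena.PercolationContinuityZ3.Theorems.PercNearOneGluingNoHeavyLowerTailMajorityGluingZThirteenEightP12
import Summits.CriticalPhenomena.PercolationContinuityZ3.Theorems.PercNearOneGluingNoHeavyLowerTailMajorityGluingZThirteenEightHG1C1
import Summits.CriticalPhenomena.PercolationContinuityZ3.Theorems.PercNearOneGluingNoHeavyLowerTailMajorityGluingZThirteenEightHG1C2
import Summits.CriticalPhenomena.PercolationContinuityZ3.Theorems.PercNearOneGluingNoHeavyLowerTailMajorityGluingZThirteenEightHG1C3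
import Summits.CriticalPhenomena.PercolationContinuityZ3.Theorems.PercNearOneGluingNoHeavyLowerTailMajorityGluingZThirteenEightHG1C4
import Summits.CriticalPhenomena.PercolationContinuityZ3.Theorems.PercNearOneGluingNoHeavyLowerTailMajorityGluingZThirteenEightHG1C5
import Summits.CriticalPhenomena.PercolationContinuityZ3.Theorems.PercNearOneGluingNoHeavyLowerTailMajorityGluingZThirteenEightHG1C6
import Summits.CriticalPhenomena.PercolationContinuityZ3.Theorems.PercNearOneGluingNoHeavyLowerTailMajorityGluingZRangeAM
import HarnessLib

/-!
# Group 1 of 4 of the `(13,8)` certificate at `c = 11/8`: its aggregate-merge tree IS the concatenation of its 6 key-range chunks (lane prim-rate, constants-miner 1, gen 39; cert/mkhier.py)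

Support file for the closed crux `NoHeavyLowerTail` (stmt-CriticalPhenomena-4575), majority-gluing line.  The 12 parts P1, P2, P3, P4, P5, P6, P7, P8, P9, P10, P11, P12 (kit j311929) carry verified
type-space digests `…D`; `thirteenEightT2G1T` is their binary tree of aggregated merges (`am`, …MajorityGluingZRangeAM, depth 4); the kernel verifies `thirteenEightT2G1T = [chunks].flatten`
(`thirteenEightT2G1_eq`), and `thirteenEightT2G1_val` identifies the value of the group's digests with the value of its chunks (`evalC_am`).  No sorries. [cite: VandenbergKahn2001, Thm 1.2 (p. 123)]
-/

namespace Summit.CriticalPhenomena.PercolationContinuityZ3.Theorems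

namespace HubOnly
namespace QCert

/-- The aggregate-merge tree of group 1. -/
def thirteenEightT2G1T : List (ℕ × ℤ) :=
  am (am (am (am (thirteenEightTP1D) (thirteenEightTP2D)) (am (thirteenEightTP3D) (thirteenEightTP4D))) (am (am (thirteenEightTP5D) (thirteenEightTP6D)) (am (thirteenEightTP7D) (thirteenEightTP8D)))) (am (am (thirteenEightTP9D) (thirteenEightTP10D)) (am (thirteenEightTP11D) (thirteenEightTP12D)))

set_option maxRecDepth 8192 in
set_option maxHeartbeats 0 in
/-- **The tree of group 1 equals the concatenation of its key-range chunks** (kernel evaluation). -/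
theorem thirteenEightT2G1_eq : thirteenEightT2G1T = [thirteenEightT2G1C1, thirteenEightT2G1C2, thirteenEightT2G1C3, thirteenEightT2G1C4, thirteenEightT2G1C5, thirteenEightT2G1C6].flatten := by
  decide +kernel

/-- The tree's value is the value of the group's digests. -/
theorem thirteenEightT2G1_treeVal (val : ℕ → ℝ) : evalC val thirteenEightT2G1T = evalC val [thirteenEightTP1D, thirteenEightTP2D, thirteenEightTP3D, thirteenEightTP4D, thirteenEightTP5D, thirteenEightTP6D, thirteenEightTP7D, thirteenEightTP8D, thirteenEightTP9D, thirteenEightTP10D, thirteenEightTP11D, thirteenEightTP12D].flatten := by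
  simp only [thirteenEightT2G1T, evalC_am, List.flatten_cons, List.flatten_nil, evalC_append, evalC_nil', add_assoc, add_zero]

/-- **The value of group 1's digests is the value of its chunks.** -/
theorem thirteenEightT2G1_val (val : ℕ → ℝ) : evalC val [thirteenEightTP1D, thirteenEightTP2D, thirteenEightTP3D, thirteenEightTP4D, thirteenEightTP5D, thirteenEightTP6D, thirteenEightTP7D, thirteenEightTP8D, thirteenEightTP9D, thirteenEightTP10D, thirteenEightTP11D, thirteenEightTP12D].flatten = evalC val [thirteenEightT2G1C1, thirteenEightT2G1C2, thirteenEightT2G1C3, thirteenEightT2G1C4, thirteenEightT2G1C5, thirteenEightT2G1C6].flatten := by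
  rw [← thirteenEightT2G1_treeVal val, thirteenEightT2G1_eq]

end QCert
end HubOnly

end Summit.CriticalPhenomena.PercolationContinuityZ3.Theorems
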